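import Mathlib.RingTheory.Valuation.ValuativeRel.Basic    -- `ValuativeRel.valuation` (Mathlib-only footing; the consumer is ★ p851800's affine frame socket)
import Mathlib.Tactic
import HarnessLib

/-!
# The centre-trace form of the isotropic cyclic frame: `T_β(x) = β·σx + σβ·x = (β∕d)·(d·σx − x)` — exact vanishing on the twisted line `x = d·σx`, and the bound
# `|T_β(a)| ≤ |ϖ^(j+1+e)|` for an Eisenstein centre `a` with `|d·σa − a| ≤ |ϖ^(j+1)|`

Topic `NumberTheory/Rogawski1990`; namespace `Literature.NumberTheory.Automorphic.UnitaryGroup`.  THEOREMS ONLY (no definition, no instance, no notation, no named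
fact, no `sorry`).  Cell `pub/hodgecm-mathlib`, F0∕P3c LH4 list, SEQUEL of ★ p851800 (LH4-plan (g6) 14:57Z ∕ WORD #90; (P5c) contract (R2)(ii)).  HC_CM is proved only modulo
the printed citations until rung 0 closes; this file is unconditional, elementary and 2-free.

THE POINT.  In the frame of ★ p851800 (`exists_antidiag_companion_frame_of_unitary_antidiagOne`: Gram `!![0, β; σβ, 0]`, companion `C(t, d)`, `d·σβ = −β`, `|d| = 1`,
`|β| = |ϖ^e|`) the hermitian trace form `T_β(x) := β·σx + σβ·x = Tr(σβ·x)` that the companion counts read (★ (β2′-ii) `htr : T_β(t) = 0`; the Eisenstein-centred count's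
`hβa′ : |T_β(a)| ≤ |ϖ^(j+1+e)|`) is `T_β(x) = (β∕d)·(d·σx − x)` (§1).  Hence `T_β(x) = 0 ⟺ x = d·σx` for `β ≠ 0` (the twisted `σ`-line through `t = tr g`), and
`|T_β(a)| = |β|·|d·σa − a| ≤ |ϖ^e|·|ϖ^(j+1)|` whenever the centre satisfies `|d·σa − a| ≤ |ϖ^(j+1)|` (§2) — which every admissible Eisenstein centre does (coordinate comparison
of `τλ = ι′λ∕d` in `K₂ = L_w[λ]`; exact `a = d·σa` when the uniformiser `Π_row` is taken in the torus field `Fix(ι′τ)`), the input being the eigen-coordinate package's export.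

* §1 (any field, `σ : K →+* K`) `antidiagTrace_eq_div_mul_sub`, `antidiagTrace_eq_zero_of_mul_map_eq`, `mul_map_eq_of_antidiagTrace_eq_zero`, `mul_map_trace_eq_trace_of_antidiagTrace`.
* §2 (`[ValuativeRel F]`) `valuation_antidiagTrace_eq`, **`valuation_antidiagTrace_le`** (the `hβa′` supplier).

## References
* [Flicker1998UnitaryFL] Y. Z. Flicker, *Elementary proof of the fundamental lemma for a unitary group*, Canad. J. Math. 50 (1998), §6 p. 97.
* [Rogawski1990] J. D. Rogawski, *Automorphic Representations of Unitary Groups in Three Variables* (1990), §3.6 p. 31.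
* [Serre1979] J.-P. Serre, *Local Fields*, GTM 67 (1979), Ch. I §6 (Eisenstein equations), Ch. V §2.
-/

set_option autoImplicit false

noncomputable section

open ValuativeRel
open scoped ValuativeRel

namespace Literature.NumberTheory.Automorphic.UnitaryGroup

/-! ## §1 The trace form `T_β(x) = β·σx + σβ·x` on the twisted line (any field) -/

section Algebra

variable {K : Type*} [Field K] (σ : K →+* K)

/-- **`T_β(x) = (β∕d)·(d·σx − x)`**: if `d·σβ = −β` (unitarity of the companion for `!![0, β; σβ, 0]`, ★ `companion_unitary_antidiag_relations`) and `d ≠ 0`, then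
`β·σx + σβ·x = (β∕d)·(d·σx − x)` for every `x`. [cite: Flicker1998UnitaryFL, §6 p. 97] [cite: Rogawski1990, §3.6 p. 31] -/
theorem antidiagTrace_eq_div_mul_sub {β d : K} (hdβ : d * σ β = -β) (hd0 : d ≠ 0) (x : K) :
    β * σ x + σ β * x = β / d * (d * σ x - x) := by
  have hσβ : σ β = -β / d := by
    rw [eq_div_iff hd0]
    linear_combination hdβ
  rw [hσβ]
  field_simp
  ring

/-- **Exact vanishing on the twisted line**: `d·σx = x ⇒ T_β(x) = 0` (for `x = tr g` this is ★ §1's `β·σt + σβ·t = 0`; for an Eisenstein centre `a` with `a = d·σa` — the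
uniformiser `Π_row` taken in the torus field — it is the exact centre-trace relation). [cite: Flicker1998UnitaryFL, §6 p. 97] [cite: Rogawski1990, §3.6 p. 31] -/
theorem antidiagTrace_eq_zero_of_mul_map_eq {β d : K} (hdβ : d * σ β = -β) (hd0 : d ≠ 0) {x : K} (hx : d * σ x = x) :
    β * σ x + σ β * x = 0 := by
  rw [antidiagTrace_eq_div_mul_sub σ hdβ hd0, hx, sub_self, mul_zero]

/-- **Converse**: for `β ≠ 0`, `T_β(x) = 0 ⇒ d·σx = x` — the kernel of `T_β` is the twisted `σ`-line. [cite: Flicker1998UnitaryFL, §6 p. 97] [cite: Rogawski1990, §3.6 p. 31] -/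
theorem mul_map_eq_of_antidiagTrace_eq_zero {β d : K} (hdβ : d * σ β = -β) (hd0 : d ≠ 0) (hβ0 : β ≠ 0) {x : K} (hx : β * σ x + σ β * x = 0) :
    d * σ x = x := by
  rw [antidiagTrace_eq_div_mul_sub σ hdβ hd0] at hx
  rcases mul_eq_zero.1 hx with h | h
  · exact absurd h (div_ne_zero hβ0 hd0)
  · exact sub_eq_zero.1 h

/-- **The trace lies on the twisted line**: from ★ §1's relations `d·σβ = −β`, `β·σt + σβ·t = 0` (`β ≠ 0`, `d ≠ 0`): `d·σt = t` — so an Eisenstein centre `a` has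
`T_β(a) = 0` iff `a` lies on the same line as `t`. [cite: Flicker1998UnitaryFL, §6 p. 97] [cite: Rogawski1990, §3.6 p. 31] -/
theorem mul_map_trace_eq_trace_of_antidiagTrace {β d t : K} (hdβ : d * σ β = -β) (hd0 : d ≠ 0) (hβ0 : β ≠ 0) (htr : β * σ t + σ β * t = 0) :
    d * σ t = t :=
  mul_map_eq_of_antidiagTrace_eq_zero σ hdβ hd0 hβ0 htr

end Algebra

/-! ## §2 Valuations: `|T_β(x)| = |β|·|d·σx − x|` and the bound `|T_β(a)| ≤ |ϖ^(j+1+e)|` -/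

section Valued

variable {F : Type*} [Field F] [ValuativeRel F] (σ : F →+* F)

/-- **`|T_β(x)| = |β|·|d·σx − x|`** when `d·σβ = −β` and `|d| = 1`. [cite: Flicker1998UnitaryFL, §6 p. 97] [cite: Serre1979, Ch. V §2] -/
theorem valuation_antidiagTrace_eq {β d : F} (hdβ : d * σ β = -β) (hd : valuation F d = 1) (x : F) :
    valuation F (β * σ x + σ β * x) = valuation F β * valuation F (d * σ x - x) := by
  have hd0 : d ≠ 0 := fun h => by rw [h, map_zero] at hd; exact zero_ne_one hd
  rw [antidiagTrace_eq_div_mul_sub σ hdβ hd0, map_mul, map_div₀, hd, div_one]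

/-- **THE CENTRE-TRACE BOUND** (the `hβa′` input of the Eisenstein-centred companion count): if `d·σβ = −β`, `|d| = 1`, `|β| = |ϖ^e|` and the centre `a` satisfies
`|d·σa − a| ≤ |ϖ^(j+1)|`, then `|β·σa + σβ·a| ≤ |ϖ^(j+1+e)|`. [cite: Flicker1998UnitaryFL, §6 p. 97] [cite: Serre1979, Ch. I §6] -/
theorem valuation_antidiagTrace_le {β d : F} (hdβ : d * σ β = -β) (hd : valuation F d = 1) {ϖ : F} {e j : ℕ}
    (hβ : valuation F β = valuation F (ϖ ^ e)) {a : F} (ha : valuation F (d * σ a - a) ≤ valuation F (ϖ ^ (j + 1))) :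
    valuation F (β * σ a + σ β * a) ≤ valuation F (ϖ ^ (j + 1 + e)) := by
  rw [valuation_antidiagTrace_eq σ hdβ hd, hβ, pow_add, map_mul, mul_comm]
  exact mul_le_mul_left ha _

/-- **Exact form, valued reading**: `d·σa = a ⇒ |β·σa + σβ·a| ≤ |ϖ^n|` for every `n` (indeed `= 0`), so the exact normalisation also meets the `hβa′` contract.
[cite: Flicker1998UnitaryFL, §6 p. 97] [cite: Serre1979, Ch. I §6] -/
theorem valuation_antidiagTrace_le_of_mul_map_eq {β d : F} (hdβ : d * σ β = -β) (hd : valuation F d = 1) {a : F} (ha : d * σ a = a) (ϖ : F) (n : ℕ) :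
    valuation F (β * σ a + σ β * a) ≤ valuation F (ϖ ^ n) := by
  have hd0 : d ≠ 0 := fun h => by rw [h, map_zero] at hd; exact zero_ne_one hd
  rw [antidiagTrace_eq_zero_of_mul_map_eq σ hdβ hd0 ha, map_zero]
  exact zero_le

end Valued

end Literature.NumberTheory.Automorphic.UnitaryGroup
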